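import Summits.MatrixMultiplication.OmegaCensus.USPWidth4SliceCert
import HarnessLib

/-!
# ω-census, family (b′) STPP / USP: the slice-structured checker for "no 8-row USP of width 4" — II: soundness of the search

HONEST FRAMING (pub-omega census; verbatim): lottery ticket; floor = certified bounds/negative ranges.
Census BOOKKEEPING machinery; no value of `ω` is touched here.  Continues `USPWidth4SliceCert.lean` (the checker `scanF`/`nodeF`/`topRun`).

What a passing run means.  Below a node holding the packed code list `P` (`n` codes) whose scan stands at code `lo`, a COMPLETION is
`codesOf P n ++ R` with `R` increasing, `8 − n` codes `≥ lo`, meeting the slice quotas (`Rem`); it is GOOD (`GoodE`) when its codes are distinct and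
form a USP (`PZ false`), obey the cap rule if `cap`, and its slice-0 part is Q6-minimal (`MinOK`).  Each filter / stream entry of the checker KILLS the
completions through its candidate (`kill_pair`, `kill_cap`, `kill_canon`, `kill_wit` — all via `PZ.subset` / `not_pz_of_refW` / `not_pz_of_badPairB` of
the kit), and a descended child covers the rest (`rem_child`); so `scan_sound` / `node_sound` / `top_sound`: if all 27 top runs pass, NO increasing
8-code list with slice sizes `(n₀, n01 − n₀, 8 − n01)` is good.  Part III (`USPWidth4SliceGlue.lean`) moves an arbitrary 8-row USP into that shape.
-/

namespace Summit.MatrixMultiplication.OmegaCensus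

open Literature.Computability.AlgebraicComplexity Equiv

namespace W4

/-! ## Semantics: completions, the side conditions, and the kills -/

/-- What remains to be chosen below a node with `n` codes whose scan stands at code `lo`: an increasing list `R` of `8 − n` codes `< 81`, all
`≥ lo`, with `n₀ − n` of them in slice 0 and `n01 − n` in slices 0–1 (truncated subtraction: a closed slice admits nothing). [folklore] -/
def Rem (n0 n01 n lo : ℕ) (R : List ℕ) : Prop :=
  R.length + n = 8 ∧ R.Pairwise (· < ·) ∧ (∀ x ∈ R, lo ≤ x ∧ x < 81) ∧
    (R.filter fun x => decide (x < 27)).length = n0 - n ∧ (R.filter fun x => decide (x < 54)).length = n01 - n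

/-- The CAP side condition (case `(3,3,2)`): every column `i < 3` carries every symbol at most three times. [folklore] -/
def CapOK (E : List ℕ) : Prop := ∀ i < 3, ∀ d < 3, E.countP (fun x => dg x i == d) ≤ 3

/-- The Q6-MINIMALITY side condition: the slice-0 part of `E` has the least key among its six column-permuted images. [folklore] -/
def MinOK (E : List ℕ) : Prop :=
  ∀ q ∈ q6, msk (E.filter fun x => decide (x < 27)) ≤ msk ((E.filter fun x => decide (x < 27)).map (actCode 0 q))

/-- A "good" completion: distinct codes forming a USP, with the cap condition (if `cap`) and Q6-minimality. [folklore] -/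
def GoodE (cap : Bool) (E : List ℕ) : Prop := E.Nodup ∧ PZ false E ∧ (cap = true → CapOK E) ∧ MinOK E

/-- `GoodE` is invariant under permutations of the list. [folklore] -/
theorem GoodE.perm {cap : Bool} {E E' : List ℕ} (h : GoodE cap E) (p : E.Perm E') : GoodE cap E' := by
  obtain ⟨hnd, hP, hc, hm⟩ := h
  have hnd' : E'.Nodup := p.nodup_iff.1 hnd
  refine ⟨hnd', hP.subset (fun x hx => p.mem_iff.2 hx) hnd', fun hcap i hi d hd => ?_, fun q hq => ?_⟩
  · rw [← p.countP_eq]; exact hc hcap i hi d hd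
  · have pf := p.filter (fun x => decide (x < 27))
    unfold msk
    rw [← (pf.map _).sum_eq, ← ((pf.map _).map _).sum_eq]
    exact hm q hq

/-- Invariant of the packed node list: codes `< 81`, and `< 27` while slice 0 is being filled. [folklore] -/
def InvP (n0 P n : ℕ) : Prop := (∀ u < n, cd P u < 81) ∧ (n ≤ n0 → ∀ u < n, cd P u < 27)

/-- Invariant of the alive mask: a clear bit `x < 81` is a clear table bit against one of the node's codes. [folklore] -/
def InvA (GT P n A : ℕ) : Prop := ∀ x < 81, A.testBit x = false → ∃ u < n, GT.testBit (81 * cd P u + x) = false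

/-- The full mask `2^81 − 1` satisfies the invariant (no clear bit below 81). [folklore] -/
theorem invA_full (GT : ℕ) : InvA GT 0 0 (2 ^ 81 - 1) := fun x hx h => by
  rw [Nat.testBit_two_pow_sub_one] at h; exact absurd (decide_eq_true hx) (by rw [h]; decide)

/-- The alive mask stays correct when a code `r < 128` is pushed and the mask is cut by its table row. [folklore] -/
theorem invA_push {GT P n A r : ℕ} (h : InvA GT P n A) (hr : r < 128) : InvA GT (r ||| (P <<< 7)) (n + 1) (A &&& goodRow GT r) := by
  intro x hx hb
  rw [Nat.testBit_and, Bool.and_eq_false_iff] at hb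
  rcases hb with hb | hb
  · obtain ⟨u, hu, h'⟩ := h x hx hb
    exact ⟨u + 1, Nat.succ_lt_succ hu, by rw [(cd_cand r P hr).2]; exact h'⟩
  · refine ⟨0, Nat.succ_pos _, ?_⟩
    rw [(cd_cand r P hr).1]
    rw [goodRow, Nat.testBit_and, Nat.testBit_two_pow_sub_one, Nat.testBit_shiftRight, Bool.and_eq_false_iff] at hb
    rcases hb with hb | hb
    · exact hb
    · exact absurd (decide_eq_true hx) (by rw [hb]; decide)

/-- `InvP` is kept when the scan pushes a candidate of the current slice. [folklore] -/
theorem invP_push {n0 n01 P n t : ℕ} (h : InvP n0 P n) (ht : t < 27) :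
    InvP n0 ((27 * sliceOf n0 n01 n + t) ||| (P <<< 7)) (n + 1) := by
  have hr : 27 * sliceOf n0 n01 n + t < 81 := by unfold sliceOf; split_ifs <;> omega
  have hr' : 27 * sliceOf n0 n01 n + t < 128 := by omega
  refine ⟨fun u hu => ?_, fun hle u hu => ?_⟩
  · rcases u with _ | u
    · rw [(cd_cand _ P hr').1]; exact hr
    · rw [(cd_cand _ P hr').2]; exact h.1 u (by omega)
  · rcases u with _ | u
    · rw [(cd_cand _ P hr').1]; unfold sliceOf; rw [if_pos (by omega)]; omega
    · rw [(cd_cand _ P hr').2]; exact h.2 (by omega) u (by omega)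

/-- KILL by the pair table: a dead alive bit at `r` puts a non-USP pair inside the completion. [folklore] -/
theorem kill_pair {GT n0 P n A r : ℕ} {R' : List ℕ} (hGT : goodTabOK GT = true) (hI : InvP n0 P n) (hA : InvA GT P n A)
    (hr : r < 81) (hb : A.testBit r = false) (hnd : (codesOf P n ++ r :: R').Nodup) : ¬ PZ false (codesOf P n ++ r :: R') := by
  intro hP
  obtain ⟨u, hu, h'⟩ := hA r hr hb
  have ha : cd P u < 81 := hI.1 u hu
  have hmem : cd P u ∈ codesOf P n := mem_codesOf.2 ⟨u, hu, rfl⟩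
  have hne : cd P u ≠ r := (List.nodup_append.1 hnd).2.2 _ hmem r (by simp)
  refine not_pz_of_badPairB (bad_of_goodTab hGT ha hr h') (hP.subset ?_ ?_)
  · intro x hx
    simp only [List.mem_cons, List.not_mem_nil, or_false] at hx
    rcases hx with rfl | rfl
    · exact List.mem_append_left _ hmem
    · simp
  · simp [hne]

/-- KILL by a witness: the stream's `(σ, τ)` refutes the candidate list, a sub-puzzle of the completion. [folklore] -/
theorem kill_wit {P n r X : ℕ} {R' : List ℕ} (hr : r < 128) (hw : witB P n r X = true) (hnd : (codesOf P n ++ r :: R').Nodup) :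
    ¬ PZ false (codesOf P n ++ r :: R') := by
  intro hP
  simp only [witB, Bool.and_eq_true] at hw
  have h1 := not_pz_of_refW (by rw [length_codesOf]; exact hw.1) (refW_of_refWP hw.1 hw.2)
  rw [codesOf_cand r P n hr] at h1
  refine h1 (hP.subset (fun x hx => ?_) ?_)
  · simp only [List.mem_cons] at hx
    rcases hx with rfl | hx
    · simp
    · exact List.mem_append_left _ hx
  · have h2 := List.nodup_append.1 hnd
    exact List.nodup_cons.2 ⟨fun hm => h2.2.2 r hm r (by simp) rfl, h2.1⟩

/-- KILL by the cap rule: the candidate's symbol would be the fourth in its column. [folklore] -/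
theorem kill_cap {P n r : ℕ} {R' : List ℕ} (hv : capViol P n r = true) : ¬ CapOK (codesOf P n ++ r :: R') := by
  intro hc
  simp only [capViol, Bool.or_eq_true, decide_eq_true_eq] at hv
  have key : ∀ i < 3, ¬ 3 ≤ cntP P i (dg r i) n := fun i hi hle => by
    have h1 := hc i hi (dg r i) (dg_lt r i)
    rw [List.countP_append, List.countP_cons, ← cntP_eq] at h1
    simp at h1; omega
  rcases hv with (hv | hv) | hv
  · exact key 0 (by decide) hv
  · exact key 1 (by decide) hv
  · exact key 2 (by decide) hv

/-- KILL by Q6-minimality: the completed slice 0 has a smaller image. [folklore] -/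
theorem kill_canon {n0 P n r : ℕ} {R' : List ℕ} (hI : InvP n0 P n) (hn : n + 1 = n0) (hr : r < 27)
    (hR : ∀ x ∈ R', 27 ≤ x) (hm : minimalB (codesOf (r ||| (P <<< 7)) (n + 1)) = false) : ¬ MinOK (codesOf P n ++ r :: R') := by
  intro hM
  have hr' : r < 128 := by omega
  rw [codesOf_cand r P n hr'] at hm
  have hf : (codesOf P n ++ r :: R').filter (fun x => decide (x < 27)) = codesOf P n ++ [r] := by
    rw [List.filter_append, List.filter_cons, if_pos (decide_eq_true hr), List.filter_eq_self.2, List.filter_eq_nil_iff.2]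
    · intro x hx; have := hR x hx; simp; omega
    · intro x hx; obtain ⟨u, hu, rfl⟩ := mem_codesOf.1 hx; exact decide_eq_true (hI.2 (by omega) u hu)
  have p : (codesOf P n ++ [r]).Perm (r :: codesOf P n) := List.perm_append_comm
  have e1 : msk (codesOf P n ++ [r]) = msk (r :: codesOf P n) := (p.map _).sum_eq
  have e2 : ∀ q, msk ((codesOf P n ++ [r]).map (actCode 0 q)) = msk ((r :: codesOf P n).map (actCode 0 q)) :=
    fun q => ((p.map _).map _).sum_eq
  have hm' : ¬ minimalB (r :: codesOf P n) = true := by rw [hm]; decide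
  simp only [minimalB, List.all_eq_true, decide_eq_true_eq, not_forall, exists_prop] at hm'
  obtain ⟨q, hq, hlt⟩ := hm'
  have h1 := hM q hq
  rw [hf, e1, e2] at h1
  exact hlt h1


/-! ## Soundness of the search -/

/-- The claim a passing node certifies: no remaining completion is good. [folklore] -/
def Claim (n0 n01 : ℕ) (cap : Bool) (P n lo : ℕ) : Prop := ∀ R, Rem n0 n01 n lo R → ¬ GoodE cap (codesOf P n ++ R)

/-- Lowering the scan position only weakens `Rem`'s demand when all remaining codes are above it anyway. [folklore] -/
theorem rem_mono {n0 n01 n lo lo' : ℕ} {R : List ℕ} (h : Rem n0 n01 n lo R) (hlo : ∀ y ∈ R, lo' ≤ y) : Rem n0 n01 n lo' R :=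
  ⟨h.1, h.2.1, fun x hx => ⟨hlo x hx, (h.2.2.1 x hx).2⟩, h.2.2.2⟩

/-- In an increasing list, if the head is `≥ b` then nothing is `< b`. [folklore] -/
theorem filter_lt_nil_of_head {x b : ℕ} {R' : List ℕ} (hs : (x :: R').Pairwise (· < ·)) (hx : b ≤ x) :
    ((x :: R').filter fun y => decide (y < b)) = [] := by
  rw [List.filter_eq_nil_iff]
  intro y hy
  rcases List.mem_cons.1 hy with rfl | hy
  · simp; omega
  · have := (List.pairwise_cons.1 hs).1 y hy; simp; omega

/-- The slice quotas place every remaining code at or above the current slice. [folklore] -/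
theorem rem_lower {n0 n01 n lo : ℕ} {R : List ℕ} (h : Rem n0 n01 n lo R) : ∀ y ∈ R, 27 * sliceOf n0 n01 n ≤ y := by
  intro y hy
  obtain ⟨-, -, -, hq0, hq1⟩ := h
  unfold sliceOf
  split_ifs with h1 h2
  · exact Nat.zero_le _
  · have : n0 - n = 0 := by omega
    rw [this, List.length_eq_zero_iff, List.filter_eq_nil_iff] at hq0
    have := hq0 y hy; simp at this; omega
  · have : n01 - n = 0 := by omega
    rw [this, List.length_eq_zero_iff, List.filter_eq_nil_iff] at hq1
    have := hq1 y hy; simp at this; omega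

/-- The head of the remaining list lies in the current slice. [folklore] -/
theorem rem_head {n0 n01 n lo x : ℕ} {R' : List ℕ} (h : Rem n0 n01 n lo (x :: R')) (hn01 : n0 ≤ n01) :
    27 * sliceOf n0 n01 n ≤ x ∧ x < 27 * sliceOf n0 n01 n + 27 := by
  refine ⟨rem_lower h x (by simp), ?_⟩
  obtain ⟨-, hs, hb, hq0, hq1⟩ := h
  unfold sliceOf
  split_ifs with h1 h2
  · by_contra hx
    rw [filter_lt_nil_of_head hs (by omega)] at hq0; simp at hq0; omega
  · by_contra hx
    rw [filter_lt_nil_of_head hs (by omega)] at hq1; simp at hq1; omega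
  · have := (hb x (by simp)).2; omega

/-- The tail of the remaining list is what remains below the child (scan position just after the head). [folklore] -/
theorem rem_tail {n0 n01 n lo x : ℕ} {R' : List ℕ} (h : Rem n0 n01 n lo (x :: R')) (hn01 : n0 ≤ n01) :
    Rem n0 n01 (n + 1) (x + 1) R' := by
  have hx := rem_head h hn01
  obtain ⟨hl, hs, hb, hq0, hq1⟩ := h
  rw [List.pairwise_cons] at hs
  refine ⟨by simp at hl; omega, hs.2, fun y hy => ⟨hs.1 y hy, (hb y (List.mem_cons_of_mem _ hy)).2⟩, ?_, ?_⟩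
  · rw [List.filter_cons] at hq0
    unfold sliceOf at hx
    split_ifs at hx with h1 h2 <;> split_ifs at hq0 with h3 <;> simp at h3 hq0 ⊢ <;> omega
  · rw [List.filter_cons] at hq1
    unfold sliceOf at hx
    split_ifs at hx with h1 h2 <;> split_ifs at hq1 with h3 <;> simp at h3 hq1 ⊢ <;> omega

/-- From the child's position `(n + 1, nextStart)`: the tail meets the child's `Rem`. [folklore] -/
theorem rem_child {n0 n01 n lo t : ℕ} {R' : List ℕ} (h : Rem n0 n01 n lo ((27 * sliceOf n0 n01 n + t) :: R')) (hn01 : n0 ≤ n01) :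
    Rem n0 n01 (n + 1) (27 * sliceOf n0 n01 (n + 1) + nextStart n0 n01 n t) R' := by
  have h1 := rem_tail h hn01
  refine rem_mono h1 fun y hy => ?_
  have hlow := rem_lower h1 y hy
  have hgt := (h1.2.2.1 y hy).1
  unfold nextStart
  split_ifs with hc
  · omega
  · have hs : sliceOf n0 n01 (n + 1) = sliceOf n0 n01 n := by unfold sliceOf; split_ifs <;> omega
    rw [hs]; omega

/-- **Soundness of the scan** (induction on the number of candidates): with a correct table, sound children and the invariants, a passing
scan refutes every completion whose head lies in the scanned range. [folklore] -/
theorem scan_sound {GT n0 n01 : ℕ} {cap : Bool} (hGT : goodTabOK GT = true) (hn01 : n0 ≤ n01)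
    {child : ℕ → ℕ → ℕ → ℕ → ℕ → Option ℕ}
    (hchild : ∀ P' n' A' st X1 X2, child P' n' A' st X1 = some X2 → InvP n0 P' n' → InvA GT P' n' A' →
      Claim n0 n01 cap P' n' (27 * sliceOf n0 n01 n' + st))
    {P n A : ℕ} (hI : InvP n0 P n) (hA : InvA GT P n A) :
    ∀ k t X X', scanF GT n0 n01 cap child P n A k t X = some X' →
      ∀ x R', Rem n0 n01 n (27 * sliceOf n0 n01 n + t) (x :: R') → x < 27 * sliceOf n0 n01 n + t + k →
        ¬ GoodE cap (codesOf P n ++ x :: R') := by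
  intro k
  induction k with
  | zero => intro t X X' _ x R' hrem hlt; have := (hrem.2.2.1 x (by simp)).1; omega
  | succ k ih =>
    intro t X X' hrun x R' hrem hlt hgood
    have hx := (hrem.2.2.1 x (by simp)).1
    rcases Nat.eq_or_lt_of_le hx with hxe | hxl
    · -- the candidate is the head
      subst hxe
      have hb27 := rem_head hrem hn01
      have ht : t < 27 := by omega
      have hr81 : 27 * sliceOf n0 n01 n + t < 81 := (hrem.2.2.1 _ (by simp)).2
      have hr128 : 27 * sliceOf n0 n01 n + t < 128 := by omega
      rw [scanF] at hrun
      by_cases hp : passB n0 cap P n A (27 * sliceOf n0 n01 n + t) = true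
      · rw [if_pos hp] at hrun
        by_cases hX : X % 2 = 1
        · rw [if_pos hX] at hrun
          cases hc : child ((27 * sliceOf n0 n01 n + t) ||| (P <<< 7)) (n + 1) (A &&& goodRow GT (27 * sliceOf n0 n01 n + t))
              (nextStart n0 n01 n t) (X / 2) with
          | none => simp [hc] at hrun
          | some Xc =>
            have hcl := hchild _ _ _ _ _ _ hc (invP_push hI ht) (invA_push hA hr128)
            refine hcl R' (rem_child hrem hn01) (hgood.perm ?_)
            rw [codesOf_cand _ P n hr128]
            exact List.perm_middle
        · rw [if_neg hX] at hrun
          by_cases hw : witB P n (27 * sliceOf n0 n01 n + t) X = true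
          · exact kill_wit hr128 hw hgood.1 hgood.2.1
          · rw [if_neg hw] at hrun; simp at hrun
      · -- the filter killed the head
        have hp' : passB n0 cap P n A (27 * sliceOf n0 n01 n + t) = false := by simpa using hp
        simp only [passB, Bool.and_eq_false_iff, Bool.not_eq_false', Bool.and_eq_true, beq_iff_eq, Bool.not_eq_true'] at hp'
        rcases hp' with (hp' | ⟨hcap, hv⟩) | ⟨hn0, hm⟩
        · exact kill_pair hGT hI hA hr81 hp' hgood.1 hgood.2.1
        · exact kill_cap hv (hgood.2.2.1 hcap)
        · have hs0 : sliceOf n0 n01 n = 0 := by unfold sliceOf; rw [if_pos (by omega)]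
          have hr27 : 27 * sliceOf n0 n01 n + t < 27 := by rw [hs0]; omega
          have h1 := rem_tail hrem hn01
          refine kill_canon hI hn0 hr27 (fun y hy => ?_) hm hgood.2.2.2
          have := rem_lower h1 y hy
          have hs1 : 1 ≤ sliceOf n0 n01 (n + 1) := by unfold sliceOf; split_ifs <;> omega
          omega
    · -- the head comes later: whatever happened at `t`, the scan went on
      have hrest : ∃ X1, scanF GT n0 n01 cap child P n A k (t + 1) X1 = some X' := by
        rw [scanF] at hrun
        split_ifs at hrun with h1 h2 h3
        · cases hc : child ((27 * sliceOf n0 n01 n + t) ||| (P <<< 7)) (n + 1) (A &&& goodRow GT (27 * sliceOf n0 n01 n + t))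
              (nextStart n0 n01 n t) (X / 2) with
          | none => simp [hc] at hrun
          | some Xc => simp only [hc] at hrun; exact ⟨Xc, hrun⟩
        · exact ⟨_, hrun⟩
        · exact ⟨_, hrun⟩
      obtain ⟨X1, h1⟩ := hrest
      refine ih (t + 1) X1 X' h1 x R' (rem_mono hrem fun y hy => ?_) (by omega) hgood
      rcases List.mem_cons.1 hy with rfl | hy
      · omega
      · have := (List.pairwise_cons.1 hrem.2.1).1 y hy; omega

/-- **Soundness of a node** (induction on the fuel). [folklore] -/
theorem node_sound {GT n0 n01 : ℕ} {cap : Bool} (hGT : goodTabOK GT = true) (hn01 : n0 ≤ n01) :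
    ∀ fuel P n A start X X', nodeF GT n0 n01 cap fuel P n A start X = some X' → InvP n0 P n → InvA GT P n A →
      Claim n0 n01 cap P n (27 * sliceOf n0 n01 n + start) := by
  intro fuel
  induction fuel with
  | zero => intro P n A start X X' h; simp [nodeF] at h
  | succ fuel ih =>
    intro P n A start X X' hrun hI hA R hrem hgood
    rw [nodeF] at hrun
    by_cases hn : 8 ≤ n
    · rw [if_pos hn] at hrun; simp at hrun
    rw [if_neg hn] at hrun
    cases R with
    | nil => have := hrem.1; simp at this; omega
    | cons x R' =>
      have hb := rem_head hrem hn01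
      exact scan_sound hGT hn01 (fun P' n' A' st X1 X2 h hI' hA' => ih P' n' A' st X1 X2 h hI' hA') hI hA
        (27 - start) start X X' hrun x R' hrem (by omega) hgood

/-- **Soundness of the top level**: if every first code `t₀ < 27` passes, no increasing 8-code list meeting the slice quotas
`(n₀, n01 − n₀, 8 − n01)` (`0 < n₀ ≤ n01`) is a good completion. [folklore] -/
theorem top_sound {GT n0 n01 : ℕ} {cap : Bool} (hGT : goodTabOK GT = true) (hn0 : 0 < n0) (hn01 : n0 ≤ n01) {S : List ℕ}
    (h : ∀ a < 27, topRun GT n0 n01 cap a 1 (S.getD a 0) = true) : ∀ R, Rem n0 n01 0 0 R → ¬ GoodE cap R := by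
  intro R hrem hgood
  cases R with
  | nil => have := hrem.1; simp at this
  | cons x R' =>
    have hs0 : sliceOf n0 n01 0 = 0 := by unfold sliceOf; rw [if_pos hn0]
    have hb := rem_head hrem hn01
    rw [hs0] at hb
    have hx : x < 27 := by omega
    have hrun := h x hx
    simp only [topRun, beq_iff_eq] at hrun
    have hI : InvP n0 0 0 := ⟨fun u hu => absurd hu (Nat.not_lt_zero _), fun _ u hu => absurd hu (Nat.not_lt_zero _)⟩
    have hrem' : Rem n0 n01 0 (27 * sliceOf n0 n01 0 + x) (x :: R') := by
      rw [hs0]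
      refine rem_mono hrem fun y hy => ?_
      rcases List.mem_cons.1 hy with rfl | hy
      · omega
      · have := (List.pairwise_cons.1 hrem.2.1).1 y hy; omega
    exact scan_sound hGT hn01 (cap := cap)
      (fun P' n' A' st X1 X2 hc hI' hA' => node_sound hGT hn01 8 P' n' A' st X1 X2 hc hI' hA') hI (invA_full GT)
      1 x (S.getD x 0) 1 hrun x R' hrem' (by rw [hs0]; omega) hgood

end W4

end Summit.MatrixMultiplication.OmegaCensus
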